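import Summits.NavierStokesRegularity.NavierStokesRegularity.Theses.PalasekTowerBreakdown
import Literature.Analysis.FluidPDE.TaoForcedUniquenessHolds

/-!
# NavierStokesRegularity — route `PalasekTowerBreakdown`, support item `TaoForcedUniqueness` (W14)

Settles `stmt-NavierStokesRegularity-19180` (support / aside item of route PalasekTowerBreakdown):

  `TaoForcedUniqueness := Literature.Analysis.FluidPDE.tao2011_forced_unconditionalUniqueness_velocity`

— Tao 2011 (Anal. PDE 6 (2013) = arXiv:1108.1165), **Cor. 11.4** (arXiv Cor. 71) WITH FORCE, velocity
form: for `ν > 0`, a force smooth on `[0,T] × ℝ³` with `‖f‖_{L^∞_t H¹_x} < ∞`, two classical solutions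
of the forced Navier–Stokes system with the same `H¹` datum, both of finite energy, have the same
velocity on `[0, T]`. The named Literature fact is now a THEOREM of the tree,
`Literature.Analysis.FluidPDE.tao2011_forced_unconditionalUniqueness_velocity_holds`
(`TaoForcedUniquenessHolds.lean`: Lemma 8.1 WITH force `tao2011_forced_finiteEnergy_energyBound_holds`
(seat lit g9) + Leray–Hopf packaging without potential hypothesis `isLerayHopfOn_of_finiteEnergy_forced_L2`
(seat lean g5) + Prop. 9.1 WITH force `lintegral_eLpNorm_top_lt_top_forced` (seat lean2) + Cor. 11.1 /
Cor. 4.3 / Thm. 5.4 (iii) WITH force `tao2011_forced_unconditionalUniqueness_velocity_of_totalSpeed` (seat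
lean2)); this file is the one-line transport to the route decl.

Cell `ns-blowup`, WAVE-1 purpose W14 ("forced Tao twins"). Since route rev 9 the deciding theorem
`PalasekTowerBreakdown.closes` no longer uses this item (PATH B′, forced Serrin–Masuda); the item was
retriaged `aside` and is closed here on its own statement. WHAT THIS IS NOT: not NS — a uniqueness
theorem for forced smooth finite-energy solutions; no crux of the route is touched.
-/

-- `Summit.<Summit>.<Problem>` is the tree's mandated summit-side namespace (CONVENTIONS §2); for this
-- single-conjunct summit the two coincide, so the duplicate is deliberate.
set_option linter.dupNamespace false

namespace Summit.NavierStokesRegularity.NavierStokesRegularity.Theorems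

open Summit.NavierStokesRegularity.NavierStokesRegularity.Theses

/-- Support item `TaoForcedUniqueness` of route PalasekTowerBreakdown (`stmt-NavierStokesRegularity-19180`):
Tao 2011, Cor. 11.4 WITH force, velocity form (W14) — PROVED, by the Literature theorem
`Literature.Analysis.FluidPDE.tao2011_forced_unconditionalUniqueness_velocity_holds`.
[cite: Tao2011, Cor. 11.4 (arXiv Cor. 71), p. 36] -/
theorem taoForcedUniqueness_proof : PalasekTowerBreakdown.TaoForcedUniqueness := by
  unfold PalasekTowerBreakdown.TaoForcedUniqueness
  exact Literature.Analysis.FluidPDE.tao2011_forced_unconditionalUniqueness_velocity_holds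

end Summit.NavierStokesRegularity.NavierStokesRegularity.Theorems
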